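import Summits.BirchSwinnertonDyer.BirchSwinnertonDyer.Theorems.KimAtThreePortSharedC3End
import Summits.BirchSwinnertonDyer.BirchSwinnertonDyer.Theorems.KimAtThreePortSharedC2Supply
import HarnessLib

/-!
# Crux `KatoKuriharaPortThreeShared` (stmt-BirchSwinnertonDyer-19560): the residual (C3) (rows with an
# anomalous bad place) REDUCED to ONE displayed Galois-cohomological clause `hLoc` — the crux BY NAME
# from (C1) + `hLoc`, and kim3's (C3) input VERBATIM from (C1) + (C2) + `hLoc`
# (cell `bsd-addord`, seat w2-acc4 gen 0; route W2 `KimAtThreeKolyvagin`; kim3 = owner/assembler)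

kim3's p448445 `KimAtThreeKolyvaginPortShared.katoKuriharaPortThreeShared_of_fineKato_of_certSupply_of_anomalousRows`
proves the crux from three displayed inputs (C1) fine Kato package, (C2) certificate supply (now a
THEOREM class-wide: w2-c3 g4 `KimAtThreePortSharedC2Supply.unitMinusSymbol_classwide` + kim3's
`certSupply_of_forall_unitMinusSymbol`), (C3) = the crux itself on the rows with an anomalous bad place
`w ≠ 3` (`E(ℚ_w)[3] ≠ 0`; 79.4 % of the Kato stratum, kit j255378).  THIS FILE replaces (C3) by the
DISPLAYED class-wide local clause `hLoc` — for every curve and every Kato `ZetaBody` family `z`, every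
generator family `η`, depth `j`, `ℤ₃`-coefficient model `(T′, red, e)` of `E[3^{j+1}]`, transport `Ψ`,
generators `σ` (`σ_q ∈ I_q`, `χ_q(σ_q) = η_q`), level `r` of Kolyvagin primes and class
`κ ∈ H¹_cont(Γ_ℚ, T′)` with `res_{U_r} κ = D_r (red_* z_{⊥,r})`: at every bad `w ≠ 3`, `w ∉ r`, with
`E(ℚ_w)[3] ≠ 0`, `loc_w (Ψ κ) ∈ 𝓕_can,w = propagatedSelmerStructure W 3 j (inr w)` ([Ru00]
Thm. 4.5.1 / [MR04] Prop. A.2 + Remark A.5 READ for the tree's tame derivative classes of Kato's system;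
the exact junction both kernel roads under construction in the cell reach: w2-c3 g5's
unramified-integrality bridge `KimAtThreeDeepUpperBadPlaceCondition…_of_unramified` (n1011-p15
T-DER-BU) and acc5's universal-norm road `KimAtThreePortSharedC3Norm*`):

* `katoKuriharaPortThreeShared_of_fineKato_of_certSupply_of_localCondition : C1 → C2 → hLoc → crux`
  (every row, anomalous or not: the seat's END `KimAtThreePortSharedC3End…_of_localCondition_of_valueRows`
  with kim3's binder discharges `ht0` / `hpN` / `hirr` / instances);
* `katoKuriharaPortThreeShared_of_fineKato_of_localCondition : C1 → hLoc → crux` ((C2) discharged);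
* kim3's (C3) input of p448445 (the crux on the anomalous rows) follows from the first theorem by
  weakening (drop the anomalous-place witness): `fun W _ _ htow … hman _ => … W htow … hman`.

HONEST LIMITS: closes nothing by itself — (C1) (construction-shaped: finite-level `exp*` riders +
`ω`-normalisation of Kato's constant) and `hLoc` stay DISPLAYED; nothing is booked; no mark moves.
No definition, no named fact, no `sorry`.

References: [Kato2004Asterisque] §8.1 (8.1.3), Prop. 8.12, §9.4, Thm. 9.7, Thm. 6.6 (1), Ex. 13.3;
[Kim2022StructureSelmer] Thm. 3.13, §3.3–§3.4.1; [MazurRubin2004] Def. 3.2.1, Thm. 3.2.4, App. A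
(Lemma A.1, Prop. A.2, Remark A.5); [Rubin2000] Def. 4.4.4, Thm. 4.5.1; kim3 memo KIM3-W2-PORT-g10 §4;
w2-c3 memo W2C3-C3-LOCAL-ANALYSIS-g4; acc5 memo ACC5-C3-MECHANISM-g0.
-/

noncomputable section

set_option linter.dupNamespace false

open scoped NumberField TensorProduct ContRepresentation Classical
open CategoryTheory Field Function Finset IsDedekindDomain NumberField WeierstrassCurve
open Rat.HeightOneSpectrum
open Literature.NumberTheory.GaloisRepresentations Literature.NumberTheory.GaloisCohomology
open Literature.NumberTheory.GaloisRepresentations.DiscreteGaloisModule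
open Literature.NumberTheory.EllipticCurves Literature.NumberTheory.EllipticCurves.ModularForms
open Literature.NumberTheory.EllipticCurves.Rank1Residual
open Literature.NumberTheory.EllipticCurves.Kato2004
open Literature.NumberTheory.EllipticCurves.Kato2004.EulerSystemValues
open Summit.BirchSwinnertonDyer.Rank1Residual.GaloisImage
open Summit.BirchSwinnertonDyer.BirchSwinnertonDyer.Theorems

namespace Summit.BirchSwinnertonDyer.BirchSwinnertonDyer.Theorems.KimAtThreePortSharedC3OfLocalCondition

/-- Local notation: `𝐃⟦A, X, U, τ⟧ ℓ = ∑_{j < ℓ−1} j·(τ_ℓ)_*^j`, Kolyvagin's derivative operator. -/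
local notation3 (prettyPrint := false) "𝐃⟦" A ", " X ", " U ", " τ "⟧" =>
  fun ℓ : HeightOneSpectrum (𝓞 ℚ) =>
  ∑ j ∈ Finset.range (((primesEquiv ℓ : Nat.Primes) : ℕ) - 1),
    (j : Module.End A (continuousCohomology 1 (subgroupRep X U))) *
      (conjMap X U ((τ : HeightOneSpectrum (𝓞 ℚ) → absoluteGaloisGroup ℚ) ℓ) 1).hom.toLinearMap ^ j

set_option backward.isDefEq.respectTransparency false in
/-- **Crux `KatoKuriharaPortThreeShared` BY NAME from (C1) + (C2) + the displayed local clause `hLoc`**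
(module docstring): every row of the crux's class — anomalous bad places allowed — by the seat's END
`katoKuriharaPortThreeAtWith₂_zero_of_zetaBody_of_localCondition_of_valueRows` on Kato's `ZetaBody`
family of (C1) and the cusp datum of (C2), the binders `ht0` / `hpN` / `hirr` and the Tate-module
instances discharged as in kim3's p448445.  Nothing is booked; (C1) and `hLoc` are displayed.
[cite: Kato2004Asterisque, (8.1.3) (p. 180), Prop. 8.12 (p. 186), §9.4 and Thm. 9.7 (pp. 188–189), Thm. 6.6 (1) (p. 163), Ex. 13.3 (pp. 224–225)]
[cite: Kim2022StructureSelmer, Thm. 3.13 and §3.3–§3.4.1]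
[cite: MazurRubin2004, Thm. 3.2.4 and App. A (Lemma A.1, Prop. A.2, Remark A.5)] [cite: Rubin2000, Thm. 4.5.1] -/
theorem katoKuriharaPortThreeShared_of_fineKato_of_certSupply_of_localCondition
    (hC1 : ∀ (W : WeierstrassCurve ℚ) [W.IsElliptic] [W.IsGloballyMinimal]
      [ContinuousSMul ℤ_[3] (W.tateModule 3)] [Module.Free ℤ_[3] (W.tateModule 3)]
      [Module.Finite ℤ_[3] (W.tateModule 3)],
      (∀ m : ℕ, W.HasSurjectiveModNGaloisRep (3 ^ m : ℕ)) →
      (haveI : Fact (Nat.Prime 3) := ⟨Nat.prime_three⟩; Addv W 3) →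
      ¬ 3 ∣ (W.baseChange ℚ_[3]).localTamagawaNumber ℤ_[3] →
      Nat.card {Q : (W.baseChange ℚ_[3]).toAffine.Point // (3 : ℕ) • Q = 0} = 1 →
      ∀ (v₃ : HeightOneSpectrum (𝓞 ℚ)), ((3 : ℕ) : 𝓞 ℚ) ∈ v₃.asIdeal →
      ∀ {N : ℕ} [NeZero N] (P : ModularParametrizationData W N), N = W.conductorNorm ℤ →
        (∀ z ∈ P.L.lattice, ∃ w ∈ periodLattice P.f, z = P.c * w) →
        ¬ (3 : ℤ) ∣ P.maninConstant →
        ∃ (ι : (n : ℕ) → (CyclotomicField n ℚ →+* ℂ)) (κK : ℝ)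
          (Λ : ∀ (k' : ℕ) (r : Finset (HeightOneSpectrum (𝓞 ℚ))),
            H1 (tateRep W 3) (cycSubgroup 3 k' r) →ₗ[ℤ_[3]]
              ℚ_[3] ⊗[ℚ] CyclotomicField (cycLevel 3 k' r) ℚ)
          (Λfin : ∀ j : ℕ, galoisCohomology
            ((W.torsionGaloisModule (((3 : ℕ) : ℤ) ^ j * ((3 : ℕ) : ℤ))).toLocal (Sum.inr v₃)) 1 →+
              ZMod (3 ^ (j + 1))),
          κK ≠ 0 ∧ (∃ u : ℚ, (u : ℝ) = κK ∧ padicValRat 3 u = 0) ∧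
          (∀ j : ℕ, KatoExpStarFiniteLevelAt W 3 j 0 v₃ Λ (Λfin j)) ∧
          ∀ (c d a : ℤ) (A : ℕ), 0 < A → Int.gcd c (6 * 3 * A) = 1 → Int.gcd d (6 * 3 * N) = 1 →
            ∃ (z : ∀ (k' : ℕ) (r : (cyclotomicLevelsRat 3 (badPlaces c d A N)).Ideals),
                  H1 (tateRep W 3) ((cyclotomicLevelsRat 3 (badPlaces c d A N)).level k' r.1))
              (x : ∀ (k' : ℕ) (r : (cyclotomicLevelsRat 3 (badPlaces c d A N)).Ideals),
                  CyclotomicField (cycLevel 3 k' r.1) ℚ),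
              ZetaBody W 3 P.f ι κK Λ c d a A z x)
    (hC2 : ∀ (W : WeierstrassCurve ℚ) [W.IsElliptic] [W.IsGloballyMinimal],
      (∀ m : ℕ, W.HasSurjectiveModNGaloisRep (3 ^ m : ℕ)) →
      (haveI : Fact (Nat.Prime 3) := ⟨Nat.prime_three⟩; Addv W 3) →
      ¬ 3 ∣ (W.baseChange ℚ_[3]).localTamagawaNumber ℤ_[3] →
      Nat.card {Q : (W.baseChange ℚ_[3]).toAffine.Point // (3 : ℕ) • Q = 0} = 1 →
      ∀ {N : ℕ} [NeZero N] (P : ModularParametrizationData W N), N = W.conductorNorm ℤ →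
        (∀ z ∈ P.L.lattice, ∃ w ∈ periodLattice P.f, z = P.c * w) →
        ¬ (3 : ℤ) ∣ P.maninConstant →
        ∃ (c d a : ℤ) (A : ℕ) (d' : ℤ) (aM : ℕ → ℤ),
          0 < A ∧ Int.gcd c (6 * 3 * A) = 1 ∧ Int.gcd d (6 * 3 * N) = 1 ∧
          (∀ q : ℕ, q.Prime → q ≡ 1 [MOD 3] → ¬ q ∣ 2 * c.natAbs * d.natAbs * A) ∧
          Int.gcd (c * d) A = 1 ∧ d * d' ≡ 1 [ZMOD (A : ℤ)] ∧ Nat.Coprime A N ∧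
          (∀ q ∈ (3 * A).primeFactors, cuspCoeff P.f q = aM q) ∧
          (∏ q ∈ (3 * A).primeFactors,
              (1 - (aM q : ℚ) / q + (if q ∣ N then 0 else (1 / q : ℚ))) ≠ 0) ∧
          padicValRat 3 (∏ q ∈ (3 * A).primeFactors,
              (1 - (aM q : ℚ) / q + (if q ∣ N then 0 else (1 / q : ℚ)))) = 0 ∧
          ((c : ℚ) ^ 2 * (d : ℚ) ^ 2 * ratMinusSymbol P.f ((a : ℚ) / A) -
              (c : ℚ) * (d : ℚ) ^ 2 * ratMinusSymbol P.f ((a * c : ℚ) / A) -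
              (c : ℚ) ^ 2 * (d : ℚ) * ratMinusSymbol P.f ((a * d' : ℚ) / A) +
              (c : ℚ) * (d : ℚ) * ratMinusSymbol P.f ((a * c * d' : ℚ) / A) ≠ 0) ∧
          padicValRat 3 ((c : ℚ) ^ 2 * (d : ℚ) ^ 2 * ratMinusSymbol P.f ((a : ℚ) / A) -
              (c : ℚ) * (d : ℚ) ^ 2 * ratMinusSymbol P.f ((a * c : ℚ) / A) -
              (c : ℚ) ^ 2 * (d : ℚ) * ratMinusSymbol P.f ((a * d' : ℚ) / A) +
              (c : ℚ) * (d : ℚ) * ratMinusSymbol P.f ((a * c * d' : ℚ) / A)) = 0)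
    (hLoc : ∀ (W : WeierstrassCurve ℚ) [W.IsElliptic] [W.IsGloballyMinimal]
      [ContinuousSMul ℤ_[3] (W.tateModule 3)] [Module.Free ℤ_[3] (W.tateModule 3)]
      [Module.Finite ℤ_[3] (W.tateModule 3)]
      {N : ℕ} [NeZero N] (P : ModularParametrizationData W N)
      {ι : (n : ℕ) → (CyclotomicField n ℚ →+* ℂ)} {κK : ℝ}
      {Λ : ∀ (k' : ℕ) (r : Finset (HeightOneSpectrum (𝓞 ℚ))),
        H1 (tateRep W 3) (cycSubgroup 3 k' r) →ₗ[ℤ_[3]] ℚ_[3] ⊗[ℚ] CyclotomicField (cycLevel 3 k' r) ℚ}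
      {c d a : ℤ} {A : ℕ}
      {z : ∀ (k' : ℕ) (r : (cyclotomicLevelsRat 3 (badPlaces c d A N)).Ideals),
        H1 (tateRep W 3) ((cyclotomicLevelsRat 3 (badPlaces c d A N)).level k' r.1)}
      {x : ∀ (k' : ℕ) (r : (cyclotomicLevelsRat 3 (badPlaces c d A N)).Ideals),
        CyclotomicField (cycLevel 3 k' r.1) ℚ},
      ZetaBody W 3 P.f ι κK Λ c d a A z x →
      ∀ (η : (q : HeightOneSpectrum (𝓞 ℚ)) → (ZMod (Ideal.absNorm q.asIdeal))ˣ) (j : ℕ) {M' : Type} [AddCommGroup M'] [Module ℤ_[3] M'] [TopologicalSpace M']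
        [DiscreteTopology M'] [IsTopologicalAddGroup M'] [ContinuousSMul ℤ_[3] M']
        {T' : GaloisRep ℚ ℤ_[3] M'} (red : (WeierstrassCurve.tateGaloisRep W 3 (W.continuous_galoisRepTate_holds 3)).toTopRep ⟶ T'.toTopRep)
        (e : M' →+ WeierstrassCurve.geomTorsion W (((3 : ℕ) : ℤ) ^ j * ((3 : ℕ) : ℤ))),
        Continuous e →
        (∀ (g : absoluteGaloisGroup ℚ) (y : M'), e (T'.toTopRep.ρ g y) =
          (W.torsionGaloisModule (((3 : ℕ) : ℤ) ^ j * ((3 : ℕ) : ℤ))).toTopRep.ρ g (e y)) →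
        (∀ b : W.tateModule 3, tateToTorsion W 3 j b = e (red.hom b)) →
      ∀ (Ψ : continuousCohomology 1 T'.toTopRep →+
        galoisCohomology (W.torsionGaloisModule (((3 : ℕ) : ℤ) ^ j * ((3 : ℕ) : ℤ))) 1),
      (∀ (φ : contOneCocycles T'.toTopRep)
        (ψ : contOneCocycles (W.torsionGaloisModule (((3 : ℕ) : ℤ) ^ j * ((3 : ℕ) : ℤ))).toTopRep),
        (∀ g, ψ.1 g = e (φ.1 g)) → Ψ (oneCocycleClass _ φ) = oneCocycleClass _ ψ) →
      ∀ (σ : HeightOneSpectrum (𝓞 ℚ) → absoluteGaloisGroup ℚ),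
        (∀ ℓ, σ ℓ ∈ (adicCompletionPrime ℚ ℓ).inertia (absoluteGaloisGroup ℚ)) →
        (∀ ℓ, modNCyclotomicCharacter ℚ (Ideal.absNorm ℓ.asIdeal) (σ ℓ) = η ℓ) →
      ∀ (r : (cyclotomicLevelsRat 3 (badPlaces c d A N)).Ideals),
        (∀ q ∈ r.1, Kato.IsKolyvaginPrime W 3 (j + 1) ((primesEquiv q : Nat.Primes) : ℕ)) →
      ∀ (comm : ((r.1 : Finset _) : Set (HeightOneSpectrum (𝓞 ℚ))).Pairwise fun a b =>
          Commute (𝐃⟦ℤ_[3], T'.toTopRep, ((cyclotomicLevelsRat 3 (badPlaces c d A N)).level ⊥ r.1), σ⟧ a)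
            (𝐃⟦ℤ_[3], T'.toTopRep, ((cyclotomicLevelsRat 3 (badPlaces c d A N)).level ⊥ r.1), σ⟧ b))
        (κ : continuousCohomology 1 T'.toTopRep),
        resSubgroup T'.toTopRep ((cyclotomicLevelsRat 3 (badPlaces c d A N)).level ⊥ r.1) 1 κ =
          (r.1.noncommProd 𝐃⟦ℤ_[3], T'.toTopRep,
              ((cyclotomicLevelsRat 3 (badPlaces c d A N)).level ⊥ r.1), σ⟧ comm)
            (ContinuousCohomology.map (ContinuousMonoidHom.id _)
              (X := subgroupRep
                (ContinuousRep.toTopRep (WeierstrassCurve.tateGaloisRep W 3 (W.continuous_galoisRepTate_holds 3)))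
                ((cyclotomicLevelsRat 3 (badPlaces c d A N)).level ⊥ r.1))
              (Y := subgroupRep (ContinuousRep.toTopRep T')
                ((cyclotomicLevelsRat 3 (badPlaces c d A N)).level ⊥ r.1))
              ((TopRep.resFunctor (Subgroup.subtype
                ((cyclotomicLevelsRat 3 (badPlaces c d A N)).level ⊥ r.1))).map red) 1 (z ⊥ r)) →
      ∀ w : HeightOneSpectrum (𝓞 ℚ), (∀ q ∈ r.1, q ≠ w) → ¬ W.HasGoodReductionAt w →
        ((primesEquiv w : Nat.Primes) : ℕ) ≠ 3 →
        (∃ Q : (W.baseChange (w.adicCompletion ℚ)).toAffine.Point, 3 • Q = 0 ∧ Q ≠ 0) →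
        galoisCohomology.localization (W.torsionGaloisModule (((3 : ℕ) : ℤ) ^ j * ((3 : ℕ) : ℤ)))
          (Sum.inr w) 1 (Ψ κ) ∈ propagatedSelmerStructure W 3 j (Sum.inr w)) :
    Summit.BirchSwinnertonDyer.BirchSwinnertonDyer.Theses.KimAtThreeKolyvagin.KatoKuriharaPortThreeShared := by
  intro W _ _ htow hadd hc3 ht v₃ hv₃ η _hη N _ P hN hlat hman
  haveI : Fact (Nat.Prime 3) := ⟨Nat.prime_three⟩
  haveI : ContinuousSMul ℤ_[3] (W.tateModule 3) := TateModule.continuousSMul_padicInt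
  haveI : Module.Free ℤ_[3] (W.tateModule 3) := W.module_free_tateModule_holds 3
  haveI : Module.Finite ℤ_[3] (W.tateModule 3) := W.module_finite_tateModule_holds 3
  obtain ⟨c, d, a, A, d', aM, hA, hcA, hdN, hcdA, hcd, hdd', hAN, haM, hE0, hE, hR0, hR⟩ :=
    hC2 W htow hadd hc3 ht P hN hlat hman
  haveI : NeZero A := ⟨hA.ne'⟩
  obtain ⟨ι, κK, Λ, Λfin, hκ0, hNorm, hfin, hz⟩ := hC1 W htow hadd hc3 ht v₃ hv₃ P hN hlat hman
  obtain ⟨z, x, hbody⟩ := hz c d a A hA hcA hdN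
  have hirr : W.HasIrreducibleModPGaloisRep 3 :=
    KimAtThreeKolyvaginPortShared.hasIrreducibleModPGaloisRep_three_of_tower W htow
  have hpN : 3 ^ 2 ∣ N := hN ▸ KimAtThreeKolyvaginPortShared.sq_dvd_conductorNorm_of_addv W hadd
  have ht0 : ∀ w : HeightOneSpectrum (𝓞 ℚ), ((3 : ℕ) : 𝓞 ℚ) ∈ w.asIdeal →
      ∀ Q : (W.baseChange (w.adicCompletion ℚ)).toAffine.Point, 3 • Q = 0 → Q = 0 :=
    fun w hw =>
      KimAtThreeKolyvaginPortShared.forall_torsion_three_eq_zero_adicCompletion_of_natCard_eq_one W ht w hw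
  exact KimAtThreePortSharedC3End.katoKuriharaPortThreeAtWith₂_zero_of_zetaBody_of_localCondition_of_valueRows
    W P hN hbody Λfin hfin hcdA ht0 (hLoc W P hbody η) hirr hNorm hκ0 d' hcd hdd' hAN hpN aM haM hE0 hE
    hR0 hR

/-- **Crux `KatoKuriharaPortThreeShared` BY NAME from (C1) + `hLoc` alone** — the certificate supply
(C2) DISCHARGED class-wide (w2-c3 g4 `unitMinusSymbol_classwide` through kim3's
`certSupply_of_forall_unitMinusSymbol`).  The EXACT residual of 19560 after this file: (C1) (fine Kato
package, construction-shaped) + `hLoc` (the anomalous-bad-place clause, [Ru00] Thm. 4.5.1 read; kernel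
roads: w2-c3 g5 / acc5).  Nothing is booked.
[cite: Kato2004Asterisque, (8.1.3) (p. 180), Prop. 8.12 (p. 186), §9.4 and Thm. 9.7 (pp. 188–189), Thm. 6.6 (1) (p. 163), Ex. 13.3 (pp. 224–225)]
[cite: Kim2022StructureSelmer, Thm. 3.13 and §3.3–§3.4.1] [cite: TateGCFT1967, §2.4 (Tchebotarev density theorem)]
[cite: MazurRubin2004, Thm. 3.2.4 and App. A (Prop. A.2, Remark A.5)] [cite: Rubin2000, Thm. 4.5.1] -/
theorem katoKuriharaPortThreeShared_of_fineKato_of_localCondition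
    (hC1 : ∀ (W : WeierstrassCurve ℚ) [W.IsElliptic] [W.IsGloballyMinimal]
      [ContinuousSMul ℤ_[3] (W.tateModule 3)] [Module.Free ℤ_[3] (W.tateModule 3)]
      [Module.Finite ℤ_[3] (W.tateModule 3)],
      (∀ m : ℕ, W.HasSurjectiveModNGaloisRep (3 ^ m : ℕ)) →
      (haveI : Fact (Nat.Prime 3) := ⟨Nat.prime_three⟩; Addv W 3) →
      ¬ 3 ∣ (W.baseChange ℚ_[3]).localTamagawaNumber ℤ_[3] →
      Nat.card {Q : (W.baseChange ℚ_[3]).toAffine.Point // (3 : ℕ) • Q = 0} = 1 →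
      ∀ (v₃ : HeightOneSpectrum (𝓞 ℚ)), ((3 : ℕ) : 𝓞 ℚ) ∈ v₃.asIdeal →
      ∀ {N : ℕ} [NeZero N] (P : ModularParametrizationData W N), N = W.conductorNorm ℤ →
        (∀ z ∈ P.L.lattice, ∃ w ∈ periodLattice P.f, z = P.c * w) →
        ¬ (3 : ℤ) ∣ P.maninConstant →
        ∃ (ι : (n : ℕ) → (CyclotomicField n ℚ →+* ℂ)) (κK : ℝ)
          (Λ : ∀ (k' : ℕ) (r : Finset (HeightOneSpectrum (𝓞 ℚ))),
            H1 (tateRep W 3) (cycSubgroup 3 k' r) →ₗ[ℤ_[3]]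
              ℚ_[3] ⊗[ℚ] CyclotomicField (cycLevel 3 k' r) ℚ)
          (Λfin : ∀ j : ℕ, galoisCohomology
            ((W.torsionGaloisModule (((3 : ℕ) : ℤ) ^ j * ((3 : ℕ) : ℤ))).toLocal (Sum.inr v₃)) 1 →+
              ZMod (3 ^ (j + 1))),
          κK ≠ 0 ∧ (∃ u : ℚ, (u : ℝ) = κK ∧ padicValRat 3 u = 0) ∧
          (∀ j : ℕ, KatoExpStarFiniteLevelAt W 3 j 0 v₃ Λ (Λfin j)) ∧
          ∀ (c d a : ℤ) (A : ℕ), 0 < A → Int.gcd c (6 * 3 * A) = 1 → Int.gcd d (6 * 3 * N) = 1 →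
            ∃ (z : ∀ (k' : ℕ) (r : (cyclotomicLevelsRat 3 (badPlaces c d A N)).Ideals),
                  H1 (tateRep W 3) ((cyclotomicLevelsRat 3 (badPlaces c d A N)).level k' r.1))
              (x : ∀ (k' : ℕ) (r : (cyclotomicLevelsRat 3 (badPlaces c d A N)).Ideals),
                  CyclotomicField (cycLevel 3 k' r.1) ℚ),
              ZetaBody W 3 P.f ι κK Λ c d a A z x)
    (hLoc : ∀ (W : WeierstrassCurve ℚ) [W.IsElliptic] [W.IsGloballyMinimal]
      [ContinuousSMul ℤ_[3] (W.tateModule 3)] [Module.Free ℤ_[3] (W.tateModule 3)]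
      [Module.Finite ℤ_[3] (W.tateModule 3)]
      {N : ℕ} [NeZero N] (P : ModularParametrizationData W N)
      {ι : (n : ℕ) → (CyclotomicField n ℚ →+* ℂ)} {κK : ℝ}
      {Λ : ∀ (k' : ℕ) (r : Finset (HeightOneSpectrum (𝓞 ℚ))),
        H1 (tateRep W 3) (cycSubgroup 3 k' r) →ₗ[ℤ_[3]] ℚ_[3] ⊗[ℚ] CyclotomicField (cycLevel 3 k' r) ℚ}
      {c d a : ℤ} {A : ℕ}
      {z : ∀ (k' : ℕ) (r : (cyclotomicLevelsRat 3 (badPlaces c d A N)).Ideals),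
        H1 (tateRep W 3) ((cyclotomicLevelsRat 3 (badPlaces c d A N)).level k' r.1)}
      {x : ∀ (k' : ℕ) (r : (cyclotomicLevelsRat 3 (badPlaces c d A N)).Ideals),
        CyclotomicField (cycLevel 3 k' r.1) ℚ},
      ZetaBody W 3 P.f ι κK Λ c d a A z x →
      ∀ (η : (q : HeightOneSpectrum (𝓞 ℚ)) → (ZMod (Ideal.absNorm q.asIdeal))ˣ) (j : ℕ) {M' : Type} [AddCommGroup M'] [Module ℤ_[3] M'] [TopologicalSpace M']
        [DiscreteTopology M'] [IsTopologicalAddGroup M'] [ContinuousSMul ℤ_[3] M']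
        {T' : GaloisRep ℚ ℤ_[3] M'} (red : (WeierstrassCurve.tateGaloisRep W 3 (W.continuous_galoisRepTate_holds 3)).toTopRep ⟶ T'.toTopRep)
        (e : M' →+ WeierstrassCurve.geomTorsion W (((3 : ℕ) : ℤ) ^ j * ((3 : ℕ) : ℤ))),
        Continuous e →
        (∀ (g : absoluteGaloisGroup ℚ) (y : M'), e (T'.toTopRep.ρ g y) =
          (W.torsionGaloisModule (((3 : ℕ) : ℤ) ^ j * ((3 : ℕ) : ℤ))).toTopRep.ρ g (e y)) →
        (∀ b : W.tateModule 3, tateToTorsion W 3 j b = e (red.hom b)) →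
      ∀ (Ψ : continuousCohomology 1 T'.toTopRep →+
        galoisCohomology (W.torsionGaloisModule (((3 : ℕ) : ℤ) ^ j * ((3 : ℕ) : ℤ))) 1),
      (∀ (φ : contOneCocycles T'.toTopRep)
        (ψ : contOneCocycles (W.torsionGaloisModule (((3 : ℕ) : ℤ) ^ j * ((3 : ℕ) : ℤ))).toTopRep),
        (∀ g, ψ.1 g = e (φ.1 g)) → Ψ (oneCocycleClass _ φ) = oneCocycleClass _ ψ) →
      ∀ (σ : HeightOneSpectrum (𝓞 ℚ) → absoluteGaloisGroup ℚ),
        (∀ ℓ, σ ℓ ∈ (adicCompletionPrime ℚ ℓ).inertia (absoluteGaloisGroup ℚ)) →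
        (∀ ℓ, modNCyclotomicCharacter ℚ (Ideal.absNorm ℓ.asIdeal) (σ ℓ) = η ℓ) →
      ∀ (r : (cyclotomicLevelsRat 3 (badPlaces c d A N)).Ideals),
        (∀ q ∈ r.1, Kato.IsKolyvaginPrime W 3 (j + 1) ((primesEquiv q : Nat.Primes) : ℕ)) →
      ∀ (comm : ((r.1 : Finset _) : Set (HeightOneSpectrum (𝓞 ℚ))).Pairwise fun a b =>
          Commute (𝐃⟦ℤ_[3], T'.toTopRep, ((cyclotomicLevelsRat 3 (badPlaces c d A N)).level ⊥ r.1), σ⟧ a)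
            (𝐃⟦ℤ_[3], T'.toTopRep, ((cyclotomicLevelsRat 3 (badPlaces c d A N)).level ⊥ r.1), σ⟧ b))
        (κ : continuousCohomology 1 T'.toTopRep),
        resSubgroup T'.toTopRep ((cyclotomicLevelsRat 3 (badPlaces c d A N)).level ⊥ r.1) 1 κ =
          (r.1.noncommProd 𝐃⟦ℤ_[3], T'.toTopRep,
              ((cyclotomicLevelsRat 3 (badPlaces c d A N)).level ⊥ r.1), σ⟧ comm)
            (ContinuousCohomology.map (ContinuousMonoidHom.id _)
              (X := subgroupRep
                (ContinuousRep.toTopRep (WeierstrassCurve.tateGaloisRep W 3 (W.continuous_galoisRepTate_holds 3)))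
                ((cyclotomicLevelsRat 3 (badPlaces c d A N)).level ⊥ r.1))
              (Y := subgroupRep (ContinuousRep.toTopRep T')
                ((cyclotomicLevelsRat 3 (badPlaces c d A N)).level ⊥ r.1))
              ((TopRep.resFunctor (Subgroup.subtype
                ((cyclotomicLevelsRat 3 (badPlaces c d A N)).level ⊥ r.1))).map red) 1 (z ⊥ r)) →
      ∀ w : HeightOneSpectrum (𝓞 ℚ), (∀ q ∈ r.1, q ≠ w) → ¬ W.HasGoodReductionAt w →
        ((primesEquiv w : Nat.Primes) : ℕ) ≠ 3 →
        (∃ Q : (W.baseChange (w.adicCompletion ℚ)).toAffine.Point, 3 • Q = 0 ∧ Q ≠ 0) →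
        galoisCohomology.localization (W.torsionGaloisModule (((3 : ℕ) : ℤ) ^ j * ((3 : ℕ) : ℤ)))
          (Sum.inr w) 1 (Ψ κ) ∈ propagatedSelmerStructure W 3 j (Sum.inr w)) :
    Summit.BirchSwinnertonDyer.BirchSwinnertonDyer.Theses.KimAtThreeKolyvagin.KatoKuriharaPortThreeShared :=
  katoKuriharaPortThreeShared_of_fineKato_of_certSupply_of_localCondition hC1
    (KimAtThreeKolyvaginPortSharedCert.certSupply_of_forall_unitMinusSymbol
      KimAtThreePortSharedC2Supply.unitMinusSymbol_classwide) hLoc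

end Summit.BirchSwinnertonDyer.BirchSwinnertonDyer.Theorems.KimAtThreePortSharedC3OfLocalCondition

end
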